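/-
Copyright: b2b-lace packet (explicit-unit carver, gen 19).  [FvdH17] §5.1 "Building blocks" (5.1)–(5.5) and
Appendix B "Detailed definition of the bounding diagrams" (arXiv:1506.07977v2 pp. 46–49 and 73–78): the UNWEIGHTED
building blocks `P^{S,b}`, `P^{E,b}`, `P^{ι,b}`, `A^{a,b}`, `A^{ι,a,b}`, `A^{a,b,*}`, `A^{ι,a,b,*}`, `Ā^{ι,a,b}`,
`Ā^{ι,a,b,*}` and the composites `B^{ι,a,b}`, `B̄^{ι,a,b}` as DEFINITIONS over a bundle of letter diagrams, with the
translation invariance that `BlockSummation` consumes PROVED for every four-point block.  Definitions and kernel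
lemmas only; no named fact; no numeral; no dimension is fixed.
-/
import Literature.Probability.FitznerVanDerHofstad2017.BlockComposition
import Literature.Probability.Percolation.DualContours
import HarnessLib

/-!
# [FvdH17] §5.1 and Appendix B: the unweighted building blocks of the diagrammatic bounds, typed

Source: R. Fitzner, R. van der Hofstad, *Mean-field behavior for nearest-neighbor percolation in `d > 10`*,
Electron. J. Probab. **22** (2017) no. 43 [FvdH17]; page numbers are those of the extended version
arXiv:1506.07977v2, "TeX l." refers to the lines of its LaTeX source `PercPaper_arxiv2017.tex`.

§5.1 (v2 p. 46, TeX l.9303–9309): "The formal definition is quite lengthly, as we need 12 different building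
blocks, where each depends on two parameters `a,b ∈ {0,1,≥2}`. Thus, we introduce them in this section only
informally in Tables … The precise definition of these diagrams is given in Appendix B.  To give an idea, we define
the block that we use to bound the initial and final triangle:
`P^{S,0}(x,y) = δ_{x,y} P(0 ⇔ x)`, (5.1)  `P^{S,1}(x,y) = δ_{0,y} B_{1̲,3}(x,0) + T_{1,1̲,1}(x,y,0)`, (5.2)
`P^{S,2}(x,y) = δ_{0,y} D_{2,2}(x) + T_{1,2,1}(x,y,0)`. (5.3)
We combine the diagrams to create larger diagrams. We define `B^{ι,a,b}` and `B̄^{ι,a,b}` by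
`B^{ι,a,b}(0,v,x,y) = Σ_{u,w} Σ_{c=0}^{2} A^{ι,a,c,*}(0,v,u,w) A^{c,b}(u,w,x,y) + Σ_u A^{ι,a,b}(0,v,x,u) P^{0}(y−u,y−u)
 + B^{(2),ι}(0,v,x,y)`, (5.4)
`B̄^{ι,a,b}(0,v,x,y) = Σ_{u,w} Σ_{c=0}^{2} A^{ι,a,c}(0,v,w,u) A^{c,b,*}(w,u,x,y) + A^{ι,a,b}(0,v,x,y) + B̄^{(2),ι,a,b}(0,v,x,y)`.
(5.5)"  Appendix B (v2 p. 73, TeX l.10451–10452): "In the appendix we define the ingredients of the bounding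
diagrams. These bounds are stated in the form of several tables. … For the diagrams we use `a = d_𝒞̃(0,v)` and
`b = d_𝒞̃(x,y)`."  The tables typed here (one Lean definition per table, one `match` arm per printed row, the
TeX line of each row in the comments):
* Table "Diagrams and definition of `P^{b}(x,y)`" (v2 p. 73, TeX l.10457–10464) — `blockPS` (`= P^{S,b}`, (5.1)–(5.3))
  and `blockPE` (`P^{E,b}`, see READING (c));
* Table "Diagrams and definition of `P^{ι,b}(x,y)`" (v2 p. 73, TeX l.10466–10479) — `blockPiota₀`;
* Table "Diagrams and definition of `A^{a,b}(0,v,x,y)`" (v2 p. 74, TeX l.10482–10496) — `blockA₀`, starred `blockAst₀`;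
* Table "Diagrams and definition of `A^{ι,a,b}(0,v,x,y)`" (v2 p. 75, TeX l.10498–10513) — `blockAiota₀`, and
  "We define `A^{ι,a,b,*}(0,v,x,y)` alike `A^{ι,a,b}(0,v,x,y)`, where we replace the repulsive diagrams `B, T, S` by
  the non-repulsive diagrams `B*, T*, S*` for `b ≠ 0`" — `blockAiotaSt₀`;
* the display "We define the double-open triangle `Ā^{ι,a,b}(0,v,x,y)` to be `Ā^{ι,a,0} = A^{ι,a,0}` (a = 0,1,2),
  `Ā^{ι,a,1} = (1/p) A^{ι,a,1}` (a = 0,1,2), `Ā^{ι,0,2}(0,v,x,y) = δ_{0,v} T*_{1,1̲,0}(−y, e_ι−y, x−y)`,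
  `Ā^{ι,1,2}(0,v,x,y) = (1/p) S*_{0,1̲,1̲,0}(v−y, −y, e_ι−y, x−y)`, `Ā^{ι,2,2}(0,v,x,y) = p τ_{0,p}(x−e_ι) τ_{0,p}(v−y)`"
  (v2 p. 78, TeX l.10593–10602) — `blockAbar₀`, and its non-repulsive twin `blockAbarSt₀` (§5.1 Table, v2 p. 47,
  TeX l.9241–9245: "`Ā^{ι,a,b,*}` … Alike … `Ā^{ι,a,b}(0,v,x,y)`, with the difference that if `b ≠ 0` the
  connections are not repulsive");
* (5.4)/(5.5) — `blockB`, `blockBbar`, with the double non-trivial triangles `B^{(2),ι,a,b}`, `B̄^{(2),ι,a,b}`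
  (App. B Tables on v2 pp. 76–77) passed as PARAMETERS `B2`, `Bbar2` (NOT typed in this module).

## How the blocks are typed

* LETTERS.  The blocks are polynomial expressions in the letter diagrams of §4.2 (v2 pp. 34–36): the modified
  two-point functions `τ_{j,p}` with an index `j ∈ {0̲,1̲,…} ∪ {0,1,…}` ("at least `m`" / "exactly `m`" occupied
  bonds, TeX l.8655–8660), `P_p(0 ⇔ x)`, the repulsive double connection `D_{j₁,j₂}(x)` (4.10), bubble `B_{j₁,j₂}`,
  triangle `T_{j₁,j₂,j₃}`, square `S_{j₁,…,j₄}`, pentagon `P_{j₁,…,j₅}` (Def. 4.1, (4.16)–(4.17): maxima over the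
  assignment of lines to independent configurations) and the non-repulsive `B*, T*, S*` = products of `τ`'s
  ((4.7)–(4.9), TeX l.8674–8682).  They enter through the function bundle `Letters d` — a `structure` of the letter
  FUNCTIONS and the parameter `p`, with NO axioms: it asserts nothing (no existence, no bound, no measurability);
  the percolation letters "as printed" (exact-length lines, maxima over assignments) are a separate construction
  NOT in this module, and every statement ABOUT the blocks is to be proved for that instance.
  The tree already holds members of these families at "at least" indices (`NobleBoundsN0.tauGe/diagDT`,
  `RepulsiveBubbleExtraction.diagBT`, `GeneralizedDisjointOccurrence.repBubble`, `RepulsiveTriangleExtraction.diagTT`,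
  `RepulsiveSquareExtraction.diagST`, `NonRepulsiveDiagramBounds.nonRepDiagram`).
* LENGTH CLASSES `a, b ∈ {0, 1, ≥2}` are `Fin 3` (`2` = "≥ 2"); directions `ι` are `Fin d × Bool` with
  `e_ι = stepVec ι` (`Percolation.stepVec`).
* CASE TABLES.  A table row "case ⟨conditions⟩ : ⟨entry⟩" is typed as `𝟙⟨conditions⟩ · ⟨entry⟩` and the rows of one
  `(a,b)` cell are SUMMED.  Every (in)equation between the displayed ARGUMENTS printed in a case cell — including the
  consequences "`b = 0 ⇒ x = y`", "`a = 0 ⇒ v = 0`", "`⇒ x ≠ 0`" — becomes a Kronecker factor `kd`/`kdc`; geometric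
  case descriptions ("`y` on sausage") carry no factor.  Moreover "`a = d_𝒞̃(0,v)`, `b = d_𝒞̃(x,y)`" (App. B p. 73)
  is imposed on EVERY row: `b = 0` rows carry `δ_{x,y}` and `a = 0` rows carry `δ_{0,v}` also where the table does
  not repeat it (rows `a ∈ {1,≥2}, b = 0` of the `A`-tables), since intrinsic distance `0` means equality — without
  it those entries do not depend on `y` and the element `(A)_{a,0} = sup_v Σ_{x,y} A^{a,0}(0,v,x,y)` would be
  infinite, while the notebook's `Bound[A,1,0] = Bound[Bubble,3]/(2dz)` is an `x`-sum.
* BASE POINT.  Four-point blocks are printed at base point `0` (`A^{a,b}(0,v,x,y)`) and used at a general base point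
  (`A^{c,b}(u,w,x,y)` in (5.4), `Ā^{ι,a,b}(u,w,t,z)` in (6.4)); all letters being probabilities of translates of
  events, `M(u,v,x,y) := M₀(v−u, x−u, y−u)` (`ofBase`), which is translation invariant BY CONSTRUCTION
  (`isTransInv_ofBase`) — the hypothesis `IsTransInv` of `BlockSummation.pairSum_comp_le`, `junction_le`,
  `vecP_recP_le_vecMul_pow`, `BlockComposition.matB_comp_le` is thereby discharged for every block of this module
  (`isTransInv_blockA`, …, `isTransInv_blockB`, `isTransInv_blockBbar`).
* ELEMENTS.  `vecPS/vecPE/vecPiota₀/matA/matAiota/matAbarIota/matBiota/matBbarIota` are the §5.1 "Elements of the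
  bounds" (v2 p. 49) as `BlockSummation.vecP/matB/matAbar` and `BlockComposition.matB₀` of these blocks (the
  `1/(2d)[δ_{0,b} + …]` normalisation of `P⃗^ι` is applied where it is consumed, as in `BlockSummation`).

READINGS (recorded, not adjudicated; package DIVERGENCE.md, provisional id D65):
(a) `B_{3,1̲}(x,0)` (Table for `P^b`, row `b = 1, y = 0`, TeX l.10460) vs `B_{1̲,3}(x,0)` in (5.2) and in §6.1
    "Case `a = 1`" (TeX l.9886): the Appendix-B table, announced as "the precise definition", is typed; by (4.16) the
    two differ only in which of the two lines is the exactly-one-bond line `x ∼ 0` read first.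
(b) `P^{E,b}` is given in words only — §5.1 Table (v2 p. 47, TeX l.9228): "For `P^{E,b}` we know that `y ≠ 0` and
    `b ≥ 1`", §6.1 (v2 p. 59, TeX l.9893–9894): "the right triangle `z,t,x` is bounded by `P^{E,b}(t−x,z−x)` … when
    `x = z`, we have the freedom to choose `t = x`, so that we can exclude the case `x = z` for `b ≥ 1`" — typed
    `P^{E,0} = P^{S,0}`, `P^{E,b}(x,y) = (1 − δ_{0,y}) P^{S,b}(x,y)` for `b ≥ 1` (the pattern of §6.1 (6.17):
    "`Q^{E,b}(x,y) = (1−δ_{0,y}) Q^{S,b}(x,y)` for `b = 1,2`"; the notebook [FvdHnb] Percolation.nb has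
    `Bound[PE,0]=1+½Bound[Bubble,2]`, `Bound[PE,1]=Bound[Bubble,3]`, `Bound[PE,2]=Bound[Triangle,4]` against
    `Bound[PS,1]=Bound[Loop,4]+Bound[Bubble,3]`, `Bound[PS,2]=Bound[Triangle,4]+½Bound[Bubble,2]`).
(c) Table `A^{a,b}` row `a = b = 0` prints the constraint "`⇒ v ≠ y, x ≠ e`" with no `ι` in scope (TeX l.10484; the
    same cell of Table `A^{ι,a,b}`, l.10500, has `e = e_ι`): the factor `x ≠ e` is typed in `A^{ι,0,0}` only.
(d) `P(0 ⇔ x)` at `x = 0`: Table for `P^b`, rows `b = 0`, gives `δ_{0,x}` for `x = 0` and `(1−δ_{0,x}) P(0 ⇔ x)` for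
    `x ≠ 0`; accordingly the letter `dbc` is only used through `pdbc L x := 𝟙{x = 0} + 𝟙{x ≠ 0} dbc x`.
(e) `Ā^{ι,0,2}` is the NON-repulsive `δ_{0,v} T*_{1,1̲,0}` (TeX l.10597) although §6.1 "Case `a = 0, b ≥ 2`"
    (l.9916) derives the repulsive `T_{1,1̲,0}(u−z,u+e_ι−z,t−z) ≤ Ā^{ι,0,2}(u,u,z,t)`; typed as defined in App. B.
(f) The non-repulsive pentagon (4.9) prints `τ_{j₄,p}(x₅−x₄)` (TeX l.8683, index `j₄` twice); no block uses `P*`,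
    it is not typed.

## References
* [FvdH17] R. Fitzner, R. van der Hofstad, Mean-field behavior for nearest-neighbor percolation in `d > 10`,
  Electron. J. Probab. 22 (2017) no. 43; arXiv:1506.07977v2 — §4.2 (4.7)–(4.17), §5.1 (5.1)–(5.5) and Tables
  (v2 pp. 46–49), §6.1 (6.4), (6.17), Appendix B (v2 pp. 73–78).
* [FvdHnb] R. Fitzner, Mathematica notebooks accompanying [FvdH17]/[NoBLE17], `Percolation.nb` (cells `Bound[PS,…]`,
  `Bound[PE,…]`, `Bound[A,…]`, `Matrix[B,s]`).
-/

noncomputable section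

namespace Literature.Probability.FitznerVanDerHofstad2017.NobleBlocks

open Literature.Probability.LatticeModels Literature.Probability.Percolation
open Literature.Probability.FitznerVanDerHofstad2017.BlockSummation
open scoped BigOperators ENNReal

variable {d : ℕ}

/-! ### A. Length indices and the letter bundle -/

/-- The lower index of a line: `ge m` = `{x ←m→ y}` ("a path of occupied, disjoint bonds … that consists of at
least `m` bonds"), `eq m` = `{x ←m̲→ y}` ("connected by a path of exactly `m` occupied bonds", the underlined
indices of the paper). [cite: FitznerVanDerHofstad2017, §4.2 "Modified two-point functions" (arXiv:1506.07977v2 p. 34)] -/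
inductive LenIdx : Type
  | ge (m : ℕ)
  | eq (m : ℕ)
  deriving DecidableEq, Inhabited

/-- The LETTER BUNDLE: the functions the building blocks are written in — `p`, `τ_{j,p}(x)`, `P_p(0 ⇔ x)`,
`D_{j₁,j₂}(x)`, `B_{j₁,j₂}(x₁,x₂)`, `T_{j₁,j₂,j₃}(x₁,x₂,x₃)`, `S_{j₁,…,j₄}(x₁,…,x₄)`, `P_{j₁,…,j₅}(x₁,…,x₅)`
(§4.2, (4.10), Def. 4.1, (4.16)–(4.17): "The repulsive square … and pentagon … are defined in the same manner").
A bundle of functions WITHOUT axioms: it asserts nothing about percolation; the percolation letters are an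
instance constructed elsewhere. [cite: FitznerVanDerHofstad2017, §4.2 (4.10), Def. 4.1, (4.16)–(4.17) (arXiv:1506.07977v2 pp. 35–36)] -/
structure Letters (d : ℕ) where
  /-- the bond density `p` (as an extended non-negative real) -/
  p : ℝ≥0∞
  /-- `τ_{j,p}(x)` -/
  tau : LenIdx → Site d → ℝ≥0∞
  /-- `P_p(0 ⇔ x)` (double connection) -/
  dbc : Site d → ℝ≥0∞
  /-- `D_{j₁,j₂}(x) = P_p({0 ←j₁→ x} ∘ {0 ←j₂→ x})` -/
  D : LenIdx → LenIdx → Site d → ℝ≥0∞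
  /-- repulsive bubble `B_{j₁,j₂}(x₁,x₂)` -/
  B : LenIdx → LenIdx → Site d → Site d → ℝ≥0∞
  /-- repulsive triangle `T_{j₁,j₂,j₃}(x₁,x₂,x₃)` -/
  T : LenIdx → LenIdx → LenIdx → Site d → Site d → Site d → ℝ≥0∞
  /-- repulsive square `S_{j₁,j₂,j₃,j₄}(x₁,x₂,x₃,x₄)` -/
  S : LenIdx → LenIdx → LenIdx → LenIdx → Site d → Site d → Site d → Site d → ℝ≥0∞
  /-- repulsive pentagon `P_{j₁,…,j₅}(x₁,…,x₅)` -/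
  P : LenIdx → LenIdx → LenIdx → LenIdx → LenIdx → Site d → Site d → Site d → Site d → Site d → ℝ≥0∞

namespace Letters

variable (L : Letters d)

/-- Non-repulsive bubble (4.7): `B*_{j₁,j₂}(x₁,x₂) = τ_{j₁,p}(x₁) τ_{j₂,p}(x₂−x₁)`.
[cite: FitznerVanDerHofstad2017, §4.2 (4.7) (arXiv:1506.07977v2 p. 34)] -/
def Bst (j₁ j₂ : LenIdx) (x₁ x₂ : Site d) : ℝ≥0∞ := L.tau j₁ x₁ * L.tau j₂ (x₂ - x₁)

/-- Non-repulsive triangle (4.8): `T*_{j₁,j₂,j₃}(x₁,x₂,x₃) = B*_{j₁,j₂}(x₁,x₂) τ_{j₃,p}(x₃−x₂)`.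
[cite: FitznerVanDerHofstad2017, §4.2 (4.8) (arXiv:1506.07977v2 p. 34)] -/
def Tst (j₁ j₂ j₃ : LenIdx) (x₁ x₂ x₃ : Site d) : ℝ≥0∞ := L.Bst j₁ j₂ x₁ x₂ * L.tau j₃ (x₃ - x₂)

/-- Non-repulsive square (4.9): `S*_{j₁,…,j₄}(x₁,…,x₄) = T*_{j₁,j₂,j₃}(x₁,x₂,x₃) τ_{j₄,p}(x₄−x₃)`.
[cite: FitznerVanDerHofstad2017, §4.2 (4.9) (arXiv:1506.07977v2 p. 34)] -/
def Sst (j₁ j₂ j₃ j₄ : LenIdx) (x₁ x₂ x₃ x₄ : Site d) : ℝ≥0∞ :=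
  L.Tst j₁ j₂ j₃ x₁ x₂ x₃ * L.tau j₄ (x₄ - x₃)

/-- `P_p(0 ⇔ x)` with the point case made explicit: `1` at `x = 0` (Table for `P^b`, row `b = 0, x = 0`:
`δ_{0,x}`) and `P_p(0 ⇔ x)` otherwise (row `b = 0, x ≠ 0`: `(1−δ_{0,x}) P(0 ⇔ x)`).
[cite: FitznerVanDerHofstad2017, App. B Table "definition of P^b(x,y)" rows b = 0 (arXiv:1506.07977v2 p. 73)] -/
def pdbc (x : Site d) : ℝ≥0∞ := if x = 0 then 1 else L.dbc x

end Letters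

/-! ### B. Kronecker factors, the nearest-neighbour factor `2dD(v)`, base points -/

/-- `δ_{x,y}`. [folklore] -/
def kd (x y : Site d) : ℝ≥0∞ := if x = y then 1 else 0

/-- `1 − δ_{x,y}`. [folklore] -/
def kdc (x y : Site d) : ℝ≥0∞ := if x = y then 0 else 1

/-- `2d D(v)` — the indicator that `v` is one of the `2d` unit vectors `e_ι` (`D` = the nearest-neighbour step
distribution). [cite: FitznerVanDerHofstad2017, §6.1 "Case a = 1" ("u and w are neighbors, 2dD(u−w) = 1") (arXiv:1506.07977v2 p. 59)] -/
def twoDD (v : Site d) : ℝ≥0∞ := if ∃ ι : Fin d × Bool, v = stepVec ι then 1 else 0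

/-- `δ_{x,x} = 1`. [folklore] -/
@[simp] theorem kd_self (x : Site d) : kd x x = 1 := by simp [kd]
/-- `δ_{x,y} = 0` for `x ≠ y`. [folklore] -/
theorem kd_of_ne {x y : Site d} (h : x ≠ y) : kd x y = 0 := by simp [kd, h]
/-- `1 − δ_{x,x} = 0`. [folklore] -/
@[simp] theorem kdc_self (x : Site d) : kdc x x = 0 := by simp [kdc]
/-- `1 − δ_{x,y} = 1` for `x ≠ y`. [folklore] -/
theorem kdc_of_ne {x y : Site d} (h : x ≠ y) : kdc x y = 1 := by simp [kdc, h]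
/-- `δ` is symmetric. [folklore] -/
theorem kd_comm (x y : Site d) : kd x y = kd y x := by simp [kd, eq_comm]
/-- `1 − δ` is symmetric. [folklore] -/
theorem kdc_comm (x y : Site d) : kdc x y = kdc y x := by simp [kdc, eq_comm]
/-- `δ ≤ 1`. [folklore] -/
theorem kd_le_one (x y : Site d) : kd x y ≤ 1 := by unfold kd; split_ifs <;> simp
/-- `1 − δ ≤ 1`. [folklore] -/
theorem kdc_le_one (x y : Site d) : kdc x y ≤ 1 := by unfold kdc; split_ifs <;> simp
/-- `δ + (1 − δ) = 1`. [folklore] -/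
theorem kd_add_kdc (x y : Site d) : kd x y + kdc x y = 1 := by unfold kd kdc; split_ifs <;> simp
/-- `2dD(v) ≤ 1`. [folklore] -/
theorem twoDD_le_one (v : Site d) : twoDD v ≤ 1 := by unfold twoDD; split_ifs <;> simp
/-- `2dD(e_ι) = 1`. [folklore] -/
theorem twoDD_stepVec (ι : Fin d × Bool) : twoDD (stepVec ι : Site d) = 1 := by
  unfold twoDD; rw [if_pos ⟨ι, rfl⟩]

/-- A four-point block from its base-point-`0` table: `M(u,v,x,y) := M₀(v−u, x−u, y−u)`.
[cite: FitznerVanDerHofstad2017, §5.1 (5.4) ("A^{c,b}(u,w,x,y)") and (6.4) (arXiv:1506.07977v2 pp. 48, 58)] -/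
def ofBase (M₀ : Site d → Site d → Site d → ℝ≥0∞) : Site d → Site d → Site d → Site d → ℝ≥0∞ :=
  fun u v x y => M₀ (v - u) (x - u) (y - u)

/-- At base point `0` the block is its table. [folklore] -/
@[simp] theorem ofBase_zero (M₀ : Site d → Site d → Site d → ℝ≥0∞) (v x y : Site d) :
    ofBase M₀ 0 v x y = M₀ v x y := by simp [ofBase]

/-- Blocks read from a base-point table are translation invariant. [folklore] -/
theorem isTransInv_ofBase (M₀ : Site d → Site d → Site d → ℝ≥0∞) : IsTransInv (ofBase M₀) := by
  intro g u v x y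
  simp [ofBase, add_sub_add_right_eq_sub]

/-- Sums of translation-invariant blocks are translation invariant. [folklore] -/
theorem isTransInv_add {M₁ M₂ : Site d → Site d → Site d → Site d → ℝ≥0∞} (h₁ : IsTransInv M₁)
    (h₂ : IsTransInv M₂) : IsTransInv (fun u v x y => M₁ u v x y + M₂ u v x y) := by
  intro g u v x y
  simp only [h₁ g, h₂ g]

/-- A block followed by a vertex kernel on its last point, `Σ_t M(u,v,x,t) q(y − t)`, is translation invariant
(the shape of the middle term `Σ_u A^{ι,a,b}(0,v,x,u) P^{0}(y−u,y−u)` of (5.4)). [folklore] -/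
theorem isTransInv_compVertex {M : Site d → Site d → Site d → Site d → ℝ≥0∞} (hM : IsTransInv M)
    (q : Site d → ℝ≥0∞) : IsTransInv (fun u v x y => ∑' t, M u v x t * q (y - t)) := by
  intro g u v x y
  simp only
  rw [← tsum_add_right_eq (fun t => M (u + g) (v + g) (x + g) t * q (y + g - t)) g]
  refine tsum_congr fun t => ?_
  simp only [hM g, add_sub_add_right_eq_sub]

/-! ### C. The start and end triangles `P^{S,b}`, `P^{E,b}` — Table for `P^b(x,y)` (v2 p. 73), (5.1)–(5.3) -/

/-- **`P^{S,b}(x,y) = P^{b}(x,y)`** — App. B Table "Diagrams and definition of `P^{b}(x,y)`" (v2 p. 73,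
TeX l.10457–10464): `b = 0 (⇒ x = y)`: `δ_{0,x}` (x = 0), `(1−δ_{0,x}) P(0 ⇔ x)` (x ≠ 0);
`b = 1 (⇒ x ≠ 0)`: `δ_{0,y} B_{3,1̲}(x,0)` (y = 0), `T_{1,1̲,1}(x,y,0)` (y ≠ 0);
`b ≥ 2 (⇒ x ≠ 0)`: `δ_{0,y} D_{2,2}(x)` (y = 0), `T_{1,2,1}(x,y,0)` (y ≠ 0).  (= (5.1)–(5.3) up to READING (a).)
[cite: FitznerVanDerHofstad2017, App. B Table "definition of P^b(x,y)" (arXiv:1506.07977v2 p. 73); §5.1 (5.1)–(5.3) (p. 46)] -/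
def blockPS (L : Letters d) (b : Fin 3) (x y : Site d) : ℝ≥0∞ :=
  match b.val with
  | 0 => kd x y * L.pdbc x                                                      -- l.10458–10459
  | 1 => kdc x 0 * (kd y 0 * L.B (.ge 3) (.eq 1) x 0 + kdc y 0 * L.T (.ge 1) (.eq 1) (.ge 1) x y 0)  -- l.10460–10461
  | _ => kdc x 0 * (kd y 0 * L.D (.ge 2) (.ge 2) x + kdc y 0 * L.T (.ge 1) (.ge 2) (.ge 1) x y 0)   -- l.10462–10463

/-- **`P^{E,b}(x,y)`** — the end triangle: `P^{E,0} = P^{S,0}` and, for `b ≥ 1`, `P^{E,b}(x,y) = (1−δ_{0,y})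
P^{S,b}(x,y)` ("For `P^{E,b}` we know that `y ≠ 0` and `b ≥ 1`"; "we can exclude the case `x = z` for `b ≥ 1`";
READING (b)). [cite: FitznerVanDerHofstad2017, §5.1 Table "Repulsive triangles P^{S,b} and P^{E,b}" (arXiv:1506.07977v2 p. 47) and §6.1 (p. 59)] -/
def blockPE (L : Letters d) (b : Fin 3) (x y : Site d) : ℝ≥0∞ :=
  match b.val with
  | 0 => blockPS L b x y
  | _ => kdc y 0 * blockPS L b x y

/-! ### D. The initial piece `P^{ι,b}` of `Ξ^ι` — Table for `P^{ι,b}(x,y)` (v2 p. 73) -/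

/-- **`P^{ι,b}(x,y)`** — App. B Table "Diagrams and definition of `P^{ι,b}(x,y)`" (v2 p. 73, TeX l.10466–10479),
`e = e_ι`: `b = 0 (⇒ x = y)`: `τ_{3,p}(e) P(e ⇔ x)`;  `b = 1`: (y on sausage) `τ_{3,p}(e) (δ_{e,y} B_{3,1̲}(x−e,0)
+ T_{1,1̲,1}(y−e,x−e,0))`, (x = e) `B_{2,1̲}(y,e)`;  `b ≥ 2`: (y on sausage) `τ_{3,p}(e) P^{(0),2}(x−e,y−e)`
(`P^{(0),2} = P^{S,2}`, (6.48)), (x = e) `δ_{0,y} τ_{3,p}(e) + B_{1,2}(y,x)`, (x ≠ e, y not on sausage)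
`(B_{1,1}(y,e) + δ_{0,y} τ_{3,p}(e)) (1−δ_{e,x}) P(e ⇔ x)`.
[cite: FitznerVanDerHofstad2017, App. B Table "definition of P^{ι,b}(x,y)" (arXiv:1506.07977v2 p. 73)] -/
def blockPiota (L : Letters d) (ι : Fin d × Bool) (b : Fin 3) (x y : Site d) : ℝ≥0∞ :=
  let e : Site d := stepVec ι
  match b.val with
  | 0 => kd x y * L.tau (.ge 3) e * L.pdbc (x - e)                                                    -- l.10469
  | 1 => L.tau (.ge 3) e * (kd y e * L.B (.ge 3) (.eq 1) (x - e) 0 + L.T (.ge 1) (.eq 1) (.ge 1) (y - e) (x - e) 0)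
         + kd x e * L.B (.ge 2) (.eq 1) y e                                                            -- l.10470–10475
  | _ => L.tau (.ge 3) e * blockPS L 2 (x - e) (y - e)                                                  -- l.10476
         + kd x e * (kd y 0 * L.tau (.ge 3) e + L.B (.ge 1) (.ge 2) y x)                                 -- l.10477
         + kdc x e * ((L.B (.ge 1) (.ge 1) y e + kd y 0 * L.tau (.ge 3) e) * L.pdbc (x - e))             -- l.10478

/-! ### E. The open triangles `A^{a,b}`, `A^{a,b,*}` — Table for `A^{a,b}(0,v,x,y)` (v2 p. 74) -/

/-- **`A^{a,b}(0,v,x,y)`** at base point `0` — App. B Table "Diagrams and definition of `A^{a,b}(0,v,x,y)`"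
(v2 p. 74, TeX l.10482–10496): `a = b = 0 (⇒ x = y, v = 0)`: `(1−δ_{0,x}) P(0 ⇔ x)`;  `a = 0, b = 1 (⇒ v = 0,
y ≠ v)`: `T_{1,1̲,1}(x,y,0)`;  `a = 0, b ≥ 2 (⇒ v = 0, y ≠ 0, x ≠ 0)`: `T_{1,2,1}(x,y,0)`;  `a = 1, b = 0`:
`2dD(v) B_{1,1}(x,v)`;  `a = b = 1`: `2dD(v) T_{1,1̲,0}(x,y,v)`;  `a = 1, b ≥ 2`: `2dD(v) T_{1,2,0}(x,y,v)`;
`a ≥ 2, b = 0`: `B_{1,0}(x,v)`;  `a ≥ 2, b = 1`: `T_{1,1̲,0}(x,y,v)`;  `a ≥ 2, b ≥ 2`: `T_{1,2,0}(x,y,v)`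
(rows `b = 0` carry `δ_{x,y}`, see the module docstring, CASE TABLES).
[cite: FitznerVanDerHofstad2017, App. B Table "definition of A^{a,b}(0,v,x,y)" (arXiv:1506.07977v2 p. 74)] -/
def blockA₀ (L : Letters d) (a b : Fin 3) (v x y : Site d) : ℝ≥0∞ :=
  match a.val, b.val with
  | 0, 0 => kd x y * kd v 0 * (kdc x 0 * L.pdbc x)                              -- l.10484–10485
  | 0, 1 => kd v 0 * kdc y v * L.T (.ge 1) (.eq 1) (.ge 1) x y 0                 -- l.10486–10487
  | 0, _ => kd v 0 * kdc y 0 * kdc x 0 * L.T (.ge 1) (.ge 2) (.ge 1) x y 0        -- l.10488–10489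
  | 1, 0 => kd x y * twoDD v * L.B (.ge 1) (.ge 1) x v                           -- l.10490
  | 1, 1 => twoDD v * L.T (.ge 1) (.eq 1) (.ge 0) x y v                          -- l.10491
  | 1, _ => twoDD v * L.T (.ge 1) (.ge 2) (.ge 0) x y v                          -- l.10492
  | _, 0 => kd x y * L.B (.ge 1) (.ge 0) x v                                     -- l.10493
  | _, 1 => L.T (.ge 1) (.eq 1) (.ge 0) x y v                                    -- l.10494
  | _, _ => L.T (.ge 1) (.ge 2) (.ge 0) x y v                                    -- l.10495

/-- **`A^{a,b,*}(0,v,x,y)`** at base point `0`: as `A^{a,b}` "with the difference that if `b ≠ 0` the connections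
are not repulsive" (§5.1 Table, v2 p. 47, TeX l.9241–9245) — `B, T ↦ B*, T*` in the rows `b ≠ 0`.
[cite: FitznerVanDerHofstad2017, §5.1 Table "Open non-repulsive diagram A^{ι,a,b,*}, A^{a,b,*}" (arXiv:1506.07977v2 p. 47); App. B (p. 74)] -/
def blockAst₀ (L : Letters d) (a b : Fin 3) (v x y : Site d) : ℝ≥0∞ :=
  match a.val, b.val with
  | 0, 0 => kd x y * kd v 0 * (kdc x 0 * L.pdbc x)
  | 0, 1 => kd v 0 * kdc y v * L.Tst (.ge 1) (.eq 1) (.ge 1) x y 0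
  | 0, _ => kd v 0 * kdc y 0 * kdc x 0 * L.Tst (.ge 1) (.ge 2) (.ge 1) x y 0
  | 1, 0 => kd x y * twoDD v * L.B (.ge 1) (.ge 1) x v
  | 1, 1 => twoDD v * L.Tst (.ge 1) (.eq 1) (.ge 0) x y v
  | 1, _ => twoDD v * L.Tst (.ge 1) (.ge 2) (.ge 0) x y v
  | _, 0 => kd x y * L.B (.ge 1) (.ge 0) x v
  | _, 1 => L.Tst (.ge 1) (.eq 1) (.ge 0) x y v
  | _, _ => L.Tst (.ge 1) (.ge 2) (.ge 0) x y v

/-- `A^{a,b}(u,v,x,y)`. [cite: FitznerVanDerHofstad2017, App. B Table "definition of A^{a,b}(0,v,x,y)" (arXiv:1506.07977v2 p. 74)] -/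
def blockA (L : Letters d) (a b : Fin 3) : Site d → Site d → Site d → Site d → ℝ≥0∞ := ofBase (blockA₀ L a b)

/-- `A^{a,b,*}(u,v,x,y)`. [cite: FitznerVanDerHofstad2017, §5.1 Table "A^{a,b,*}" (arXiv:1506.07977v2 p. 47)] -/
def blockAst (L : Letters d) (a b : Fin 3) : Site d → Site d → Site d → Site d → ℝ≥0∞ :=
  ofBase (blockAst₀ L a b)

/-! ### F. The open triangles with one pivotal edge `A^{ι,a,b}`, `A^{ι,a,b,*}` — Table for `A^{ι,a,b}` (v2 p. 75) -/

/-- **`A^{ι,a,b}(0,v,x,y)`** at base point `0`, `e = e_ι` — App. B Table "Diagrams and definition of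
`A^{ι,a,b}(0,v,x,y)`" (v2 p. 75, TeX l.10498–10511): `a = b = 0 (⇒ x = y, v = 0 ⇒ v ≠ y, x ≠ e)`:
`T_{1,1̲,1}(e,x,0)`;  `a = 0, b = 1 (⇒ v = 0, y ≠ v)`: `δ_{x,e} T_{1̲,1̲,2}(e,y,0) + S_{1̲,1,1̲,1}(e,x,y,0)`;
`a = 0, b ≥ 2 (⇒ v = 0, y ≠ 0, x ≠ 0)`: `S_{1̲,0,2,1}(e,x,y,0)`;  `a = 1, b = 0 (⇒ x ≠ 0)`: `2dD(v) T_{1̲,1,0}(e,x,v)`;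
`a = b = 1`: `2dD(v) S_{1̲,0,1̲,0}(e,x,y,v)`;  `a = 1, b ≥ 2`: `2dD(v) S_{1̲,0,2,0}(e,x,y,v)`;  `a ≥ 2, b = 0`:
`T_{1̲,1,0}(e,x,v)`;  `a ≥ 2, b = 1`: `S_{1̲,0,1̲,0}(e,x,y,v)`;  `a ≥ 2, b ≥ 2`: `S_{1̲,0,2,0}(e,x,y,v)`
(rows `b = 0` carry `δ_{x,y}`). [cite: FitznerVanDerHofstad2017, App. B Table "definition of A^{ι,a,b}(0,v,x,y)" (arXiv:1506.07977v2 p. 75)] -/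
def blockAiota₀ (L : Letters d) (ι : Fin d × Bool) (a b : Fin 3) (v x y : Site d) : ℝ≥0∞ :=
  let e : Site d := stepVec ι
  match a.val, b.val with
  | 0, 0 => kd x y * kd v 0 * kdc v y * kdc x e * L.T (.ge 1) (.eq 1) (.ge 1) e x 0                  -- l.10500
  | 0, 1 => kd v 0 * kdc y v *
            (kd x e * L.T (.eq 1) (.eq 1) (.ge 2) e y 0 + L.S (.eq 1) (.ge 1) (.eq 1) (.ge 1) e x y 0)   -- l.10501–10502
  | 0, _ => kd v 0 * kdc y 0 * kdc x 0 * L.S (.eq 1) (.ge 0) (.ge 2) (.ge 1) e x y 0                  -- l.10503–10504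
  | 1, 0 => kd x y * kdc x 0 * twoDD v * L.T (.eq 1) (.ge 1) (.ge 0) e x v                          -- l.10505
  | 1, 1 => twoDD v * L.S (.eq 1) (.ge 0) (.eq 1) (.ge 0) e x y v                                    -- l.10506
  | 1, _ => twoDD v * L.S (.eq 1) (.ge 0) (.ge 2) (.ge 0) e x y v                                    -- l.10507
  | _, 0 => kd x y * L.T (.eq 1) (.ge 1) (.ge 0) e x v                                               -- l.10508
  | _, 1 => L.S (.eq 1) (.ge 0) (.eq 1) (.ge 0) e x y v                                              -- l.10509
  | _, _ => L.S (.eq 1) (.ge 0) (.ge 2) (.ge 0) e x y v                                              -- l.10510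

/-- **`A^{ι,a,b,*}(0,v,x,y)`** at base point `0`: "We define `A^{ι,a,b,*}(0,v,x,y)` alike `A^{ι,a,b}(0,v,x,y)`,
where we replace the repulsive diagrams `B, T, S` by the non-repulsive diagrams `B*, T*, S*` for `b ≠ 0`."
[cite: FitznerVanDerHofstad2017, App. B, sentence after Table "definition of A^{ι,a,b}" (arXiv:1506.07977v2 p. 75)] -/
def blockAiotaSt₀ (L : Letters d) (ι : Fin d × Bool) (a b : Fin 3) (v x y : Site d) : ℝ≥0∞ :=
  let e : Site d := stepVec ι
  match a.val, b.val with
  | 0, 0 => kd x y * kd v 0 * kdc v y * kdc x e * L.T (.ge 1) (.eq 1) (.ge 1) e x 0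
  | 0, 1 => kd v 0 * kdc y v *
            (kd x e * L.Tst (.eq 1) (.eq 1) (.ge 2) e y 0 + L.Sst (.eq 1) (.ge 1) (.eq 1) (.ge 1) e x y 0)
  | 0, _ => kd v 0 * kdc y 0 * kdc x 0 * L.Sst (.eq 1) (.ge 0) (.ge 2) (.ge 1) e x y 0
  | 1, 0 => kd x y * kdc x 0 * twoDD v * L.T (.eq 1) (.ge 1) (.ge 0) e x v
  | 1, 1 => twoDD v * L.Sst (.eq 1) (.ge 0) (.eq 1) (.ge 0) e x y v
  | 1, _ => twoDD v * L.Sst (.eq 1) (.ge 0) (.ge 2) (.ge 0) e x y v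
  | _, 0 => kd x y * L.T (.eq 1) (.ge 1) (.ge 0) e x v
  | _, 1 => L.Sst (.eq 1) (.ge 0) (.eq 1) (.ge 0) e x y v
  | _, _ => L.Sst (.eq 1) (.ge 0) (.ge 2) (.ge 0) e x y v

/-- `A^{ι,a,b}(u,v,x,y)`. [cite: FitznerVanDerHofstad2017, App. B Table "definition of A^{ι,a,b}(0,v,x,y)" (arXiv:1506.07977v2 p. 75)] -/
def blockAiota (L : Letters d) (ι : Fin d × Bool) (a b : Fin 3) : Site d → Site d → Site d → Site d → ℝ≥0∞ :=
  ofBase (blockAiota₀ L ι a b)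

/-- `A^{ι,a,b,*}(u,v,x,y)`. [cite: FitznerVanDerHofstad2017, App. B, sentence after Table "definition of A^{ι,a,b}" (arXiv:1506.07977v2 p. 75)] -/
def blockAiotaSt (L : Letters d) (ι : Fin d × Bool) (a b : Fin 3) :
    Site d → Site d → Site d → Site d → ℝ≥0∞ :=
  ofBase (blockAiotaSt₀ L ι a b)

/-! ### G. The double-open triangles `Ā^{ι,a,b}`, `Ā^{ι,a,b,*}` (v2 p. 78) -/

/-- **`Ā^{ι,a,b}(0,v,x,y)`** at base point `0`, `e = e_ι` (App. B, v2 p. 78, TeX l.10593–10602):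
`Ā^{ι,a,0} = A^{ι,a,0}` and `Ā^{ι,a,1} = (1/p) A^{ι,a,1}` for `a = 0,1,2`;
`Ā^{ι,0,2}(0,v,x,y) = δ_{0,v} T*_{1,1̲,0}(−y, e−y, x−y)`;  `Ā^{ι,1,2}(0,v,x,y) = (1/p) S*_{0,1̲,1̲,0}(v−y,−y,e−y,x−y)`;
`Ā^{ι,2,2}(0,v,x,y) = p τ_{0,p}(x−e) τ_{0,p}(v−y)`.
[cite: FitznerVanDerHofstad2017, App. B, display "We define the double-open triangle Ā^{ι,a,b}" (arXiv:1506.07977v2 p. 78)] -/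
def blockAbar₀ (L : Letters d) (ι : Fin d × Bool) (a b : Fin 3) (v x y : Site d) : ℝ≥0∞ :=
  let e : Site d := stepVec ι
  match a.val, b.val with
  | _, 0 => blockAiota₀ L ι a b v x y                                           -- l.10595
  | _, 1 => L.p⁻¹ * blockAiota₀ L ι a b v x y                                   -- l.10596
  | 0, _ => kd v 0 * L.Tst (.ge 1) (.eq 1) (.ge 0) (-y) (e - y) (x - y)          -- l.10597–10598
  | 1, _ => L.p⁻¹ * L.Sst (.ge 0) (.eq 1) (.eq 1) (.ge 0) (v - y) (-y) (e - y) (x - y)  -- l.10599–10600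
  | _, _ => L.p * L.tau (.ge 0) (x - e) * L.tau (.ge 0) (v - y)                  -- l.10601

/-- **`Ā^{ι,a,b,*}(0,v,x,y)`** at base point `0`: "Alike … `Ā^{ι,a,b}(0,v,x,y)`, with the difference that if
`b ≠ 0` the connections are not repulsive" — `(1/p) A^{ι,a,1,*}` in the rows `b = 1`; the rows `b = 0` (repulsive)
and `b ≥ 2` (already non-repulsive) as in `Ā^{ι,a,b}`.
[cite: FitznerVanDerHofstad2017, §5.1 Table "Open non-repulsive diagram … Ā^{ι,a,b,*}" (arXiv:1506.07977v2 p. 47); App. B (p. 78)] -/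
def blockAbarSt₀ (L : Letters d) (ι : Fin d × Bool) (a b : Fin 3) (v x y : Site d) : ℝ≥0∞ :=
  match a.val, b.val with
  | _, 1 => L.p⁻¹ * blockAiotaSt₀ L ι a b v x y
  | _, _ => blockAbar₀ L ι a b v x y

/-- `Ā^{ι,a,b}(u,v,x,y)`. [cite: FitznerVanDerHofstad2017, App. B, display "double-open triangle Ā^{ι,a,b}" (arXiv:1506.07977v2 p. 78)] -/
def blockAbar (L : Letters d) (ι : Fin d × Bool) (a b : Fin 3) : Site d → Site d → Site d → Site d → ℝ≥0∞ :=
  ofBase (blockAbar₀ L ι a b)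

/-- `Ā^{ι,a,b,*}(u,v,x,y)`. [cite: FitznerVanDerHofstad2017, §5.1 Table "Ā^{ι,a,b,*}" (arXiv:1506.07977v2 p. 47)] -/
def blockAbarSt (L : Letters d) (ι : Fin d × Bool) (a b : Fin 3) :
    Site d → Site d → Site d → Site d → ℝ≥0∞ :=
  ofBase (blockAbarSt₀ L ι a b)

/-! ### H. The composites `B^{ι,a,b}`, `B̄^{ι,a,b}` of (5.4)–(5.5) -/

/-- The type of a family of four-point blocks indexed by a direction and two length classes
(`B^{(2),ι,a,b}`, `B̄^{(2),ι,a,b}`, `B^{ι,a,b}`, …). [cite: FitznerVanDerHofstad2017, §5.1 (arXiv:1506.07977v2 pp. 46–49)] -/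
abbrev DirBlockFamily (d : ℕ) : Type :=
  Fin d × Bool → Fin 3 → Fin 3 → Site d → Site d → Site d → Site d → ℝ≥0∞

/-- **`B^{ι,a,b}`** (5.4): `B^{ι,a,b}(0,v,x,y) = Σ_{u,w} Σ_{c=0}^{2} A^{ι,a,c,*}(0,v,u,w) A^{c,b}(u,w,x,y)
+ Σ_u A^{ι,a,b}(0,v,x,u) P^{0}(y−u,y−u) + B^{(2),ι}(0,v,x,y)`, at a general base point, with the double
non-trivial triangle `B^{(2),ι,a,b}` as the parameter `B2` (`P^{0}(z,z) = P^{S,0}(z,z)`, Table for `P^b`).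
[cite: FitznerVanDerHofstad2017, §5.1 (5.4) (arXiv:1506.07977v2 p. 48)] -/
def blockB (L : Letters d) (B2 : DirBlockFamily d) : DirBlockFamily d := fun ι a b u v x y =>
  (∑ c : Fin 3, comp (blockAiotaSt L ι a c) (blockA L c b) u v x y)
    + (∑' t, blockAiota L ι a b u v x t * blockPS L 0 (y - t) (y - t))
    + B2 ι a b u v x y

/-- **`B̄^{ι,a,b}`** (5.5): `B̄^{ι,a,b}(0,v,x,y) = Σ_{u,w} Σ_{c=0}^{2} A^{ι,a,c}(0,v,w,u) A^{c,b,*}(w,u,x,y)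
+ A^{ι,a,b}(0,v,x,y) + B̄^{(2),ι,a,b}(0,v,x,y)`, with `B̄^{(2),ι,a,b}` as the parameter `Bbar2`.
[cite: FitznerVanDerHofstad2017, §5.1 (5.5) (arXiv:1506.07977v2 p. 48)] -/
def blockBbar (L : Letters d) (Bbar2 : DirBlockFamily d) : DirBlockFamily d := fun ι a b u v x y =>
  (∑ c : Fin 3, comp (blockAiota L ι a c) (blockAst L c b) u v x y)
    + blockAiota L ι a b u v x y
    + Bbar2 ι a b u v x y

/-! ### I. Translation invariance of every block (the hypothesis of `BlockSummation`/`BlockComposition`) -/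

/-- `A^{a,b}` is translation invariant. [folklore] -/
theorem isTransInv_blockA (L : Letters d) (a b : Fin 3) : IsTransInv (blockA L a b) := isTransInv_ofBase _
/-- `A^{a,b,*}` is translation invariant. [folklore] -/
theorem isTransInv_blockAst (L : Letters d) (a b : Fin 3) : IsTransInv (blockAst L a b) := isTransInv_ofBase _
/-- `A^{ι,a,b}` is translation invariant. [folklore] -/
theorem isTransInv_blockAiota (L : Letters d) (ι : Fin d × Bool) (a b : Fin 3) :
    IsTransInv (blockAiota L ι a b) := isTransInv_ofBase _
/-- `A^{ι,a,b,*}` is translation invariant. [folklore] -/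
theorem isTransInv_blockAiotaSt (L : Letters d) (ι : Fin d × Bool) (a b : Fin 3) :
    IsTransInv (blockAiotaSt L ι a b) := isTransInv_ofBase _
/-- `Ā^{ι,a,b}` is translation invariant. [folklore] -/
theorem isTransInv_blockAbar (L : Letters d) (ι : Fin d × Bool) (a b : Fin 3) :
    IsTransInv (blockAbar L ι a b) := isTransInv_ofBase _
/-- `Ā^{ι,a,b,*}` is translation invariant. [folklore] -/
theorem isTransInv_blockAbarSt (L : Letters d) (ι : Fin d × Bool) (a b : Fin 3) :
    IsTransInv (blockAbarSt L ι a b) := isTransInv_ofBase _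

/-- `B^{ι,a,b}` is translation invariant whenever `B^{(2),ι,a,b}` is. [folklore] -/
theorem isTransInv_blockB (L : Letters d) {B2 : DirBlockFamily d} (hB2 : ∀ ι a b, IsTransInv (B2 ι a b))
    (ι : Fin d × Bool) (a b : Fin 3) : IsTransInv (blockB L B2 ι a b) := by
  have h1 : IsTransInv (fun u v x y => ∑ c : Fin 3, comp (blockAiotaSt L ι a c) (blockA L c b) u v x y) :=
    IsTransInv.finsetSum Finset.univ fun c _ =>
      IsTransInv.comp (isTransInv_blockAiotaSt L ι a c) (isTransInv_blockA L c b)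
  have h2 : IsTransInv (fun u v x y => ∑' t, blockAiota L ι a b u v x t * blockPS L 0 (y - t) (y - t)) :=
    isTransInv_compVertex (isTransInv_blockAiota L ι a b) (fun z => blockPS L 0 z z)
  exact isTransInv_add (isTransInv_add h1 h2) (hB2 ι a b)

/-- `B̄^{ι,a,b}` is translation invariant whenever `B̄^{(2),ι,a,b}` is. [folklore] -/
theorem isTransInv_blockBbar (L : Letters d) {Bbar2 : DirBlockFamily d}
    (hBbar2 : ∀ ι a b, IsTransInv (Bbar2 ι a b)) (ι : Fin d × Bool) (a b : Fin 3) :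
    IsTransInv (blockBbar L Bbar2 ι a b) := by
  have h1 : IsTransInv (fun u v x y => ∑ c : Fin 3, comp (blockAiota L ι a c) (blockAst L c b) u v x y) :=
    IsTransInv.finsetSum Finset.univ fun c _ =>
      IsTransInv.comp (isTransInv_blockAiota L ι a c) (isTransInv_blockAst L c b)
  exact isTransInv_add (isTransInv_add h1 (isTransInv_blockAiota L ι a b)) (hBbar2 ι a b)

/-! ### J. Elements of the bounds (§5.1, v2 p. 49) for these blocks -/

/-- `(P⃗^S)_b = Σ_{x,y} P^{S,b}(x,y)`. [cite: FitznerVanDerHofstad2017, §5.1 "Elements of the bounds" (arXiv:1506.07977v2 p. 49)] -/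
def vecPS (L : Letters d) : Fin 3 → ℝ≥0∞ := vecP (blockPS L)

/-- `(P⃗^E)_b = Σ_{x,y} P^{E,b}(x,y)`. [cite: FitznerVanDerHofstad2017, §5.1 "Elements of the bounds" (arXiv:1506.07977v2 p. 49)] -/
def vecPE (L : Letters d) : Fin 3 → ℝ≥0∞ := vecP (blockPE L)

/-- `Σ_{ι,x,y} P^{ι,b}(x,y)` — the sum inside `(P⃗^ι)_b = (1/2d)[δ_{0,b} + Σ_{ι,x,y} P^{ι,b}(x,y)]`.
[cite: FitznerVanDerHofstad2017, §5.1 "Elements of the bounds" (arXiv:1506.07977v2 p. 49)] -/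
def vecPiotaSum (L : Letters d) : Fin 3 → ℝ≥0∞ := vecP (fun b x y => ∑ ι : Fin d × Bool, blockPiota L ι b x y)

/-- `(A)_{a,b} = sup_v Σ_{x,y} A^{a,b}(0,v,x,y)`. [cite: FitznerVanDerHofstad2017, §5.1 "Elements of the bounds" (arXiv:1506.07977v2 p. 49)] -/
def matA (L : Letters d) : Matrix (Fin 3) (Fin 3) ℝ≥0∞ := matB₀ (blockA L)

/-- `(A*)_{a,b}`. [cite: FitznerVanDerHofstad2017, §5.1 "Elements of the bounds" (arXiv:1506.07977v2 p. 49)] -/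
def matAst (L : Letters d) : Matrix (Fin 3) (Fin 3) ℝ≥0∞ := matB₀ (blockAst L)

/-- `(A^ι)_{a,b} = sup_v Σ_{ι,x,y} A^{ι,a,b}(0,v,x,y)`. [cite: FitznerVanDerHofstad2017, §5.1 "Elements of the bounds" (arXiv:1506.07977v2 p. 49)] -/
def matAiota (L : Letters d) : Matrix (Fin 3) (Fin 3) ℝ≥0∞ := matB (blockAiota L)

/-- `(A^{ι,*})_{a,b}`. [cite: FitznerVanDerHofstad2017, §5.1 "Elements of the bounds" (arXiv:1506.07977v2 p. 49)] -/
def matAiotaSt (L : Letters d) : Matrix (Fin 3) (Fin 3) ℝ≥0∞ := matB (blockAiotaSt L)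

/-- `(Ā^ι)_{a,b} = sup_{v,y} Σ_{ι,x} Ā^{ι,a,b}(0,v,x,x+y)`. [cite: FitznerVanDerHofstad2017, §5.1 "Elements of the bounds" (arXiv:1506.07977v2 p. 49)] -/
def matAbarIota (L : Letters d) : Matrix (Fin 3) (Fin 3) ℝ≥0∞ := matAbar (blockAbar L)

/-- `(Ā^{ι,*})_{a,b}`. [cite: FitznerVanDerHofstad2017, §5.1 "Elements of the bounds" (arXiv:1506.07977v2 p. 49)] -/
def matAbarIotaSt (L : Letters d) : Matrix (Fin 3) (Fin 3) ℝ≥0∞ := matAbar (blockAbarSt L)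

/-- `(B)_{a,b} = sup_v Σ_{ι,x,y} B^{ι,a,b}(0,v,x,y)`. [cite: FitznerVanDerHofstad2017, §5.1 "Elements of the bounds" (arXiv:1506.07977v2 p. 49)] -/
def matBiota (L : Letters d) (B2 : DirBlockFamily d) : Matrix (Fin 3) (Fin 3) ℝ≥0∞ := matB (blockB L B2)

/-- `(B̄)_{a,b} = sup_v Σ_{ι,x,y} B̄^{ι,a,b}(0,v,x,y)`. [cite: FitznerVanDerHofstad2017, §5.1 "Elements of the bounds" (arXiv:1506.07977v2 p. 49)] -/
def matBbarIota (L : Letters d) (Bbar2 : DirBlockFamily d) : Matrix (Fin 3) (Fin 3) ℝ≥0∞ :=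
  matB (blockBbar L Bbar2)

/-! ### K. Unfolding lemmas at base point `0` (how a table row is read back) -/

/-- `A^{a,b}(0,v,x,y)` is the table entry. [folklore] -/
@[simp] theorem blockA_zero (L : Letters d) (a b : Fin 3) (v x y : Site d) :
    blockA L a b 0 v x y = blockA₀ L a b v x y := ofBase_zero _ _ _ _
/-- `A^{ι,a,b}(0,v,x,y)` is the table entry. [folklore] -/
@[simp] theorem blockAiota_zero (L : Letters d) (ι : Fin d × Bool) (a b : Fin 3) (v x y : Site d) :
    blockAiota L ι a b 0 v x y = blockAiota₀ L ι a b v x y := ofBase_zero _ _ _ _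
/-- `Ā^{ι,a,b}(0,v,x,y)` is the display's entry. [folklore] -/
@[simp] theorem blockAbar_zero (L : Letters d) (ι : Fin d × Bool) (a b : Fin 3) (v x y : Site d) :
    blockAbar L ι a b 0 v x y = blockAbar₀ L ι a b v x y := ofBase_zero _ _ _ _

/-- Row `a ≥ 2, b ≥ 2` of the `A`-table: `A^{2,2}(0,v,x,y) = T_{1,2,0}(x,y,v)`.
[cite: FitznerVanDerHofstad2017, App. B Table "definition of A^{a,b}(0,v,x,y)", last row (arXiv:1506.07977v2 p. 74)] -/
theorem blockA₀_two_two (L : Letters d) (v x y : Site d) :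
    blockA₀ L 2 2 v x y = L.T (.ge 1) (.ge 2) (.ge 0) x y v := rfl

/-- Row `a = 1, b = 0` of the `A`-table with its `b = 0 ⇒ x = y` factor: `A^{1,0}(0,v,x,y) = δ_{x,y} 2dD(v) B_{1,1}(x,v)`.
[cite: FitznerVanDerHofstad2017, App. B Table "definition of A^{a,b}(0,v,x,y)", row a = 1, b = 0 (arXiv:1506.07977v2 p. 74)] -/
theorem blockA₀_one_zero (L : Letters d) (v x y : Site d) :
    blockA₀ L 1 0 v x y = kd x y * twoDD v * L.B (.ge 1) (.ge 1) x v := rfl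

/-- `Ā^{ι,2,2}(0,v,x,y) = p τ_{0,p}(x−e_ι) τ_{0,p}(v−y)`.
[cite: FitznerVanDerHofstad2017, App. B, display "double-open triangle Ā^{ι,a,b}", last line (arXiv:1506.07977v2 p. 78)] -/
theorem blockAbar₀_two_two (L : Letters d) (ι : Fin d × Bool) (v x y : Site d) :
    blockAbar₀ L ι 2 2 v x y = L.p * L.tau (.ge 0) (x - stepVec ι) * L.tau (.ge 0) (v - y) := rfl

/-- `Ā^{ι,a,1} = (1/p) A^{ι,a,1}`. [cite: FitznerVanDerHofstad2017, App. B, display "double-open triangle Ā^{ι,a,b}", second line (arXiv:1506.07977v2 p. 78)] -/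
theorem blockAbar₀_one (L : Letters d) (ι : Fin d × Bool) (a : Fin 3) (v x y : Site d) :
    blockAbar₀ L ι a 1 v x y = L.p⁻¹ * blockAiota₀ L ι a 1 v x y := by
  unfold blockAbar₀
  rcases a with ⟨_ | _ | _ | n, ha⟩
  · rfl
  · rfl
  · rfl
  · exfalso; omega

/-- `P^{S,0}(x,y) = δ_{x,y} P(0 ⇔ x)` ((5.1), with the point case of READING (d)).
[cite: FitznerVanDerHofstad2017, §5.1 (5.1) (arXiv:1506.07977v2 p. 46)] -/
theorem blockPS_zero (L : Letters d) (x y : Site d) : blockPS L 0 x y = kd x y * L.pdbc x := rfl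

/-- `P^{E,0} = P^{S,0}`. [cite: FitznerVanDerHofstad2017, §5.1 Table "P^{S,b} and P^{E,b}" (arXiv:1506.07977v2 p. 47)] -/
theorem blockPE_zero (L : Letters d) (x y : Site d) : blockPE L 0 x y = blockPS L 0 x y := rfl

/-- `P^{E,b}(x,y) = (1−δ_{0,y}) P^{S,b}(x,y)` for `b = 1, 2`. [cite: FitznerVanDerHofstad2017, §6.1 (arXiv:1506.07977v2 p. 59)] -/
theorem blockPE_of_ne_zero (L : Letters d) {b : Fin 3} (hb : b ≠ 0) (x y : Site d) :
    blockPE L b x y = kdc y 0 * blockPS L b x y := by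
  unfold blockPE
  rcases b with ⟨_ | _ | _ | n, hb'⟩
  · exact absurd rfl hb
  · rfl
  · rfl
  · exfalso; omega

end Literature.Probability.FitznerVanDerHofstad2017.NobleBlocks

end
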